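import Literature.Barriers.AnomalousDissipation.ShearFlowViscositySelectionTransport
import Literature.Analysis.FunctionSpaces.SmoothParametricIntegral
import Literature.Analysis.FunctionSpaces.TorusScalarTrigPoly
import Literature.Analysis.FunctionSpaces.WeakExponentialODE
import Literature.Analysis.FluidPDE.PassiveScalarFourier
import HarnessLib

/-!
# Bardos–Titi–Wiedemann 2012, Lemma 4 — uniqueness by duality, and the discharge of the named
fact `BardosTitiWiedemann2012_lemma4`

Companion to `ShearFlowViscositySelectionLimit.lean` (the named fact) and
`ShearFlowViscositySelectionTransport.lean` (the existence conjunct). Theorem-only. Lemma 4 of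
Bardos–Titi–Wiedemann (C. R. Math. 350 (2012)): for `v ∈ L²(T)`, `w₀ ∈ L²(T²)`, the Cauchy
problem `∂ₜw + v(x₂)∂₁w = 0`, `w(0) = w₀` has a weakly continuous weak solution and "this solution
is unique in the class `L^∞((0,T);L²(T²))`. We omit the elementary proof of the Lemma." This file
**proves the uniqueness conjunct** by a duality argument that needs no regularity of `v` beyond
`L²`, and assembles `BardosTitiWiedemann2012_lemma4_holds`.

## The argument

Let `θ, θ'` be weak solutions (accepted `Torus.IsWeakScalarTransportOn T 0 (shearVelocity v) θ₀`)
and `δ = θ - θ'`. Subtracting the weak identities, `∫₀ᵀ∫ δ (∂ₜψ + v(x₂)∂₁ψ) = 0` for every test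
`ψ` (`setIntegral_integral_sub_mul_transport_eq_zero`; integrability on `(0,T) × T²` from
`δ ∈ L²_{t,x}` and the clause `uθ ∈ L¹`). Let `V_N` be the Fourier truncations of `V(x) = v(x₂)`:
smooth, independent of `x₁` (`scalarTruncate_shear_add_single`), `V_N → V` in `L²`
(`Torus.tendsto_integral_sq_sub_scalarTruncate`). For a test `χ`, the **dual test**
`φ_N(t,x) = -∫₀ᵀ χ(t + r, (x₁ + rV_N(x), x₂)) dr` is a space–time test
(`isSpaceTimeTest_dual`, smooth parametric integral —
`Literature.Analysis.FunctionSpaces.contDiff_parametric_intervalIntegral_comp`), with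
`∂ₜφ_N = -∫₀ᵀ ∂ₜχ`, `∂₁φ_N = -∫₀ᵀ ∂₁χ` along the characteristics (`timeDeriv_dual`,
`partialDeriv_dual`, differentiation under the integral sign), hence
`∂ₜφ_N + V_N ∂₁φ_N = χ` for `t ≥ 0` (`transport_dual`, fundamental theorem of calculus along the
characteristics) and `|∂₁φ_N| ≤ K` with `K` independent of `N` (`exists_bound_partialDeriv_dual`).
Testing with `φ_N`: `∫∫ δχ = -∫∫ δ (V - V_N) ∂₁φ_N`, so
`|∫∫ δχ| ≤ K T ‖δ‖_{L^∞L²} ‖V - V_N‖_{L²} → 0` (`setIntegral_integral_sub_mul_test_eq_zero`).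
Finally (`ae_ae_eq_of_isWeakScalarTransportOn`), testing with `η'(t)g(x)` and the weak ODE lemma
`Literature.Analysis.FunctionSpaces.ae_eq_exp_smul_of_forall_integral_deriv_sub` (`λ = 0`) give
`∫ δ(t) g = 0` for a.e. `t` for each smooth `g`; over the countable family `Re(z e_{-k})` all
Fourier coefficients of `δ(t)` vanish for a.e. `t`, and Parseval gives `δ(t) = 0`.

* `BardosTitiWiedemann2012_lemma4_holds : BardosTitiWiedemann2012_lemma4` — existence from the
  Transport file, uniqueness from here.

## References

* C. Bardos, E. S. Titi, E. Wiedemann, C. R. Math. Acad. Sci. Paris 350 (2012) 757–760, Lemma 4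
  (`BardosTitiWiedemann2012`).
* C. Bardos, E. S. Titi, Discrete Contin. Dyn. Syst. Ser. S 3 (2010), Thm. 2 (`BardosTiti2010`).
* L. C. Evans, *Partial Differential Equations* (2010), §3.2 (characteristics), App. C
  (differentiation under the integral) (`Evans2010`).
-/

open MeasureTheory Set Filter Topology Function UnitAddTorus intervalIntegral
open scoped ENNReal NNReal InnerProductSpace RealInnerProductSpace ContDiff

noncomputable section

namespace Literature.Barriers.AnomalousDissipation

/-- The flat two-torus `T² = (ℝ/ℤ)²` (local notation). -/
local notation "𝕋²" => UnitAddTorus (Fin 2)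

/-! ## Characteristics with a shifted time argument -/

section Characteristics

variable {T : ℝ} {χ : ℝ → 𝕋² → ℝ}

/-- **Derivative of a test function along the characteristics, shifted time**:
`d/dr χ(t + r, (x₁ + r c, x₂)) = (∂ₜχ + c ∂₁χ)(t + r, ·)` at the moving point. [folklore] -/
theorem hasDerivAt_test_comp_skew_shift (hχ : Literature.Analysis.FunctionSpaces.Torus.IsSpaceTimeTest T χ)
    (t c : ℝ) (x : 𝕋²) (r : ℝ) :
    HasDerivAt (fun ρ => χ (t + ρ) ![x 0 + ((ρ * c : ℝ) : UnitAddCircle), x 1])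
      (Literature.Analysis.FunctionSpaces.Torus.timeDeriv χ (t + r) ![x 0 + ((r * c : ℝ) : UnitAddCircle), x 1] +
        c * Literature.Analysis.FunctionSpaces.Torus.partialDeriv 0 (χ (t + r))
          ![x 0 + ((r * c : ℝ) : UnitAddCircle), x 1]) r := by
  -- the time-shifted test function
  set χ' : ℝ → 𝕋² → ℝ := fun s y => χ (t + s) y with hχ'
  have hχ's : Literature.Analysis.FunctionSpaces.Torus.IsSpaceTimeTest (T - t) χ' := by
    obtain ⟨hs, T', hT'T, hT'⟩ := hχ
    refine ⟨?_, T' - t, by linarith, fun s hs' => ?_⟩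
    · have h : Literature.Analysis.FunctionSpaces.Torus.stLift χ' =
          Literature.Analysis.FunctionSpaces.Torus.stLift χ ∘ fun p : ℝ × EuclideanSpace ℝ (Fin 2) => (t + p.1, p.2) := by
        funext p; rfl
      rw [h]
      exact hs.comp ((contDiff_const.add contDiff_fst).prodMk contDiff_snd)
    · exact hT' (t + s) (by linarith)
  have h := hasDerivAt_test_comp_skew hχ's c x r
  have htd : ∀ s y, Literature.Analysis.FunctionSpaces.Torus.timeDeriv χ' s y =
      Literature.Analysis.FunctionSpaces.Torus.timeDeriv χ (t + s) y := by
    intro s y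
    simp only [Literature.Analysis.FunctionSpaces.Torus.timeDeriv, hχ']
    rw [← deriv_comp_const_add (fun τ => χ τ y) t s]
  rw [htd] at h
  exact h

/-- Integrating the shifted derivative: for `t` with `χ(t + T, ·) = 0`,
`∫₀ᵀ (∂ₜχ + c∂₁χ)(t + r, (x₁ + rc, x₂)) dr = -χ(t, x)`. [folklore] -/
theorem integral_deriv_test_comp_skew_shift (hχ : Literature.Analysis.FunctionSpaces.Torus.IsSpaceTimeTest T χ)
    (t c : ℝ) (x : 𝕋²) (hzero : χ (t + T) = 0) :
    ∫ r in (0 : ℝ)..T, (Literature.Analysis.FunctionSpaces.Torus.timeDeriv χ (t + r)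
        ![x 0 + ((r * c : ℝ) : UnitAddCircle), x 1] +
      c * Literature.Analysis.FunctionSpaces.Torus.partialDeriv 0 (χ (t + r))
        ![x 0 + ((r * c : ℝ) : UnitAddCircle), x 1]) = -χ t x := by
  have hq : Continuous fun r : ℝ => (![x 0 + ((r * c : ℝ) : UnitAddCircle), x 1] : 𝕋²) := by
    refine continuous_pi fun i => ?_
    fin_cases i
    · show Continuous fun r : ℝ => x 0 + ((r * c : ℝ) : UnitAddCircle)
      exact continuous_const.add ((AddCircle.continuous_mk' _).comp (continuous_id.mul continuous_const))
    · exact continuous_const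
  have hcont : Continuous fun r : ℝ => Literature.Analysis.FunctionSpaces.Torus.timeDeriv χ (t + r)
        ![x 0 + ((r * c : ℝ) : UnitAddCircle), x 1] +
      c * Literature.Analysis.FunctionSpaces.Torus.partialDeriv 0 (χ (t + r))
        ![x 0 + ((r * c : ℝ) : UnitAddCircle), x 1] :=
    (hχ.continuous_uncurry_timeDeriv.comp ((continuous_const.add continuous_id).prodMk hq)).add
      (continuous_const.mul ((hχ.continuous_uncurry_partialDeriv 0).comp
        ((continuous_const.add continuous_id).prodMk hq)))
  rw [integral_eq_sub_of_hasDerivAt (fun r _ => hasDerivAt_test_comp_skew_shift hχ t c x r)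
    (hcont.intervalIntegrable _ _), hzero]
  simp [vec2_eta]

end Characteristics

/-! ## The dual test function: solving the adjoint transport equation along characteristics -/

section DualTest

variable {T : ℝ} {χ : ℝ → 𝕋² → ℝ} {W : 𝕋² → ℝ}

/-- An axis-0-invariant function on `T²` depends on `x₂` only. [folklore] -/
theorem eq_of_inv0 (hWinv : ∀ (s : UnitAddCircle) (x : 𝕋²), W (x + Pi.single 0 s) = W x) (x : 𝕋²)
    (s : UnitAddCircle) : W ![x 0 + s, x 1] = W x := by
  have h : (![x 0 + s, x 1] : 𝕋²) = x + Pi.single 0 s := by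
    funext i; fin_cases i <;> simp
  rw [h, hWinv]

/-- **The dual test function is a space–time test function.** For a space–time test `χ` on
`T² × [0,T)`, `T ≥ 0`, and a smooth `W : T² → ℝ`,
`φ(t,x) = -∫₀ᵀ χ(t + r, (x₁ + r W(x), x₂)) dr` is again a space–time test on `T² × [0,T)`:
smooth as a parametric integral of a smooth integrand
(`Literature.Analysis.FunctionSpaces.contDiff_parametric_intervalIntegral_comp`), and vanishing
for `t ≥ T'` when `χ` does. [folklore] -/
theorem isSpaceTimeTest_dual (hχ : Literature.Analysis.FunctionSpaces.Torus.IsSpaceTimeTest T χ) (hT : 0 ≤ T)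
    (hW : Literature.Analysis.FunctionSpaces.Torus.IsSmooth W) :
    Literature.Analysis.FunctionSpaces.Torus.IsSpaceTimeTest T (fun t x =>
      -∫ r in (0 : ℝ)..T, χ (t + r) ![x 0 + ((r * W x : ℝ) : UnitAddCircle), x 1]) := by
  obtain ⟨hs, T', hT'T, hT'⟩ := hχ
  refine ⟨?_, T', hT'T, fun t ht => ?_⟩
  · set e₀ : EuclideanSpace ℝ (Fin 2) := EuclideanSpace.single (0 : Fin 2) (1 : ℝ) with he₀
    have hlift : Literature.Analysis.FunctionSpaces.Torus.stLift (fun t x =>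
        -∫ r in (0 : ℝ)..T, χ (t + r) ![x 0 + ((r * W x : ℝ) : UnitAddCircle), x 1]) =
        fun p : ℝ × EuclideanSpace ℝ (Fin 2) => -∫ r in (0 : ℝ)..T,
          Literature.Analysis.FunctionSpaces.Torus.stLift χ
            (p.1 + r, p.2 + (r * Literature.Analysis.FunctionSpaces.Torus.lift W p.2) • e₀) := by
      funext p
      obtain ⟨t, Y⟩ := p
      simp only [Literature.Analysis.FunctionSpaces.Torus.stLift_apply]
      have hint : ∀ r : ℝ, χ (t + r) ![(Literature.Analysis.FunctionSpaces.Torus.proj Y) 0 +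
          ((r * W (Literature.Analysis.FunctionSpaces.Torus.proj Y) : ℝ) : UnitAddCircle),
            (Literature.Analysis.FunctionSpaces.Torus.proj Y) 1] =
          Literature.Analysis.FunctionSpaces.Torus.stLift χ
            (t + r, Y + (r * Literature.Analysis.FunctionSpaces.Torus.lift W Y) • e₀) := fun r => by
        rw [skewPoint_eq_proj (Literature.Analysis.FunctionSpaces.Torus.proj Y) (yl := Y) rfl
          (W (Literature.Analysis.FunctionSpaces.Torus.proj Y)) r]
        rfl
      simp_rw [hint]
      rfl
    rw [hlift]
    refine (Literature.Analysis.FunctionSpaces.contDiff_parametric_intervalIntegral_comp hs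
      (A := fun q : ℝ × (ℝ × EuclideanSpace ℝ (Fin 2)) =>
        (q.2.1 + q.1, q.2.2 + (q.1 * Literature.Analysis.FunctionSpaces.Torus.lift W q.2.2) • e₀)) ?_ 0 T).neg
    have hW' : ContDiff ℝ ∞ (Literature.Analysis.FunctionSpaces.Torus.lift W) := hW
    exact ((contDiff_fst.comp contDiff_snd).add contDiff_fst).prodMk
      ((contDiff_snd.comp contDiff_snd).add
        ((contDiff_fst.mul (hW'.comp (contDiff_snd.comp contDiff_snd))).smul contDiff_const))
  · funext x
    simp only [Pi.zero_apply, neg_eq_zero]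
    refine intervalIntegral.integral_zero_ae (Eventually.of_forall fun r hr => ?_)
    have hr0 : 0 < r := by
      rw [uIoc_of_le hT] at hr
      exact hr.1
    rw [hT' (t + r) (by linarith)]
    rfl

end DualTest

/-! ## Derivatives of the dual test function -/

section DualDerivatives

variable {T : ℝ} {χ : ℝ → 𝕋² → ℝ} {W : 𝕋² → ℝ}

/-- Differentiation under the integral sign in one real parameter, smooth integrand on a compact
interval: `d/ds ∫ₐᵇ K(r, s) dr = ∫ₐᵇ ∂ₛK(r, s) dr`
(`Literature.Analysis.FunctionSpaces.fderiv_parametric_intervalIntegral_apply` with `P = ℝ`). [folklore] -/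
theorem deriv_parametric_intervalIntegral {K : ℝ × ℝ → ℝ} (hK : ContDiff ℝ ∞ K) (a b s₀ : ℝ) :
    deriv (fun s => ∫ r in a..b, K (r, s)) s₀ = ∫ r in a..b, deriv (fun s => K (r, s)) s₀ := by
  have h1 : deriv (fun s => ∫ r in a..b, K (r, s)) s₀ = fderiv ℝ (fun s => ∫ r in a..b, K (r, s)) s₀ 1 := rfl
  rw [h1, Literature.Analysis.FunctionSpaces.fderiv_parametric_intervalIntegral_apply hK (by simp) a b s₀ 1]
  refine intervalIntegral.integral_congr fun r _ => ?_
  have h2 := (Literature.Analysis.FunctionSpaces.hasFDerivAt_comp_prodMk hK (by simp) r s₀).hasDerivAt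
  rw [h2.deriv]
  simp

/-- The characteristic points `(x₁ + r c, x₂)` lie on an affine line of lifts: with a lift `Yx`
of `x`, `(x₁ + r c, x₂) = proj (Yx + (r c) e₀)`, and shifting `x₁` by `s` shifts the lift by
`s e₀`. [folklore] -/
theorem skewPoint_add_proj (x : 𝕋²) {Yx : EuclideanSpace ℝ (Fin 2)}
    (hYx : Literature.Analysis.FunctionSpaces.Torus.proj Yx = x) (c r s : ℝ) :
    (![x 0 + ((r * c : ℝ) : UnitAddCircle), x 1] : 𝕋²) +
        Literature.Analysis.FunctionSpaces.Torus.proj (s • EuclideanSpace.single (0 : Fin 2) (1 : ℝ)) =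
      Literature.Analysis.FunctionSpaces.Torus.proj
        (Yx + (r * c) • EuclideanSpace.single (0 : Fin 2) (1 : ℝ) + s • EuclideanSpace.single (0 : Fin 2) (1 : ℝ)) := by
  rw [Literature.Analysis.FunctionSpaces.Torus.proj_add, ← skewPoint_eq_proj x hYx c r]

/-- **Time derivative of the dual test function**:
`∂ₜ φ(t,x) = -∫₀ᵀ (∂ₜχ)(t + r, (x₁ + rW(x), x₂)) dr`. [folklore] -/
theorem timeDeriv_dual (hχ : Literature.Analysis.FunctionSpaces.Torus.IsSpaceTimeTest T χ) (W : 𝕋² → ℝ)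
    (t : ℝ) (x : 𝕋²) :
    Literature.Analysis.FunctionSpaces.Torus.timeDeriv (fun t x =>
        -∫ r in (0 : ℝ)..T, χ (t + r) ![x 0 + ((r * W x : ℝ) : UnitAddCircle), x 1]) t x =
      -∫ r in (0 : ℝ)..T, Literature.Analysis.FunctionSpaces.Torus.timeDeriv χ (t + r)
        ![x 0 + ((r * W x : ℝ) : UnitAddCircle), x 1] := by
  obtain ⟨Yx, hYx⟩ := Literature.Analysis.FunctionSpaces.Torus.proj_surjective x
  set e₀ : EuclideanSpace ℝ (Fin 2) := EuclideanSpace.single (0 : Fin 2) (1 : ℝ) with he₀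
  -- the smooth kernel `H (r, τ) = χ (τ + r) (x₁ + r W(x), x₂)`
  set H : ℝ × ℝ → ℝ := fun q => Literature.Analysis.FunctionSpaces.Torus.stLift χ
    (q.2 + q.1, Yx + (q.1 * W x) • e₀) with hH
  have hHs : ContDiff ℝ ∞ H :=
    hχ.1.comp ((contDiff_snd.add contDiff_fst).prodMk
      (contDiff_const.add ((contDiff_fst.mul contDiff_const).smul contDiff_const)))
  have hHeq : ∀ r τ, χ (τ + r) ![x 0 + ((r * W x : ℝ) : UnitAddCircle), x 1] = H (r, τ) := fun r τ => by
    rw [skewPoint_eq_proj x hYx (W x) r]; rfl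
  simp only [Literature.Analysis.FunctionSpaces.Torus.timeDeriv]
  simp_rw [hHeq]
  rw [show (fun τ : ℝ => -∫ r in (0 : ℝ)..T, H (r, τ)) = -(fun τ : ℝ => ∫ r in (0 : ℝ)..T, H (r, τ)) from rfl,
    deriv.neg, deriv_parametric_intervalIntegral hHs]
  congr 1
  refine intervalIntegral.integral_congr fun r _ => ?_
  have h : (fun τ => H (r, τ)) = fun τ => (fun s => χ s ![x 0 + ((r * W x : ℝ) : UnitAddCircle), x 1]) (τ + r) := by
    funext τ; exact (hHeq r τ).symm
  rw [h]
  have hdiff : Differentiable ℝ (fun s : ℝ => χ s ![x 0 + ((r * W x : ℝ) : UnitAddCircle), x 1]) := by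
    rw [skewPoint_eq_proj x hYx (W x) r]
    exact (hχ.1.differentiable (by simp)).comp (differentiable_id.prodMk (differentiable_const _))
  exact ((hdiff (t + r)).hasDerivAt.comp_add_const t r).deriv

/-- **First spatial derivative of the dual test function**, for `W` independent of `x₁`:
`∂₁ φ(t,x) = -∫₀ᵀ (∂₁χ)(t + r, (x₁ + rW(x), x₂)) dr`. [folklore] -/
theorem partialDeriv_dual (hχ : Literature.Analysis.FunctionSpaces.Torus.IsSpaceTimeTest T χ)
    (hWinv : ∀ (s : UnitAddCircle) (x : 𝕋²), W (x + Pi.single 0 s) = W x) (t : ℝ) (x : 𝕋²) :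
    Literature.Analysis.FunctionSpaces.Torus.partialDeriv 0 (fun x : 𝕋² =>
        -∫ r in (0 : ℝ)..T, χ (t + r) ![x 0 + ((r * W x : ℝ) : UnitAddCircle), x 1]) x =
      -∫ r in (0 : ℝ)..T, Literature.Analysis.FunctionSpaces.Torus.partialDeriv 0 (χ (t + r))
        ![x 0 + ((r * W x : ℝ) : UnitAddCircle), x 1] := by
  obtain ⟨Yx, hYx⟩ := Literature.Analysis.FunctionSpaces.Torus.proj_surjective x
  set e₀ : EuclideanSpace ℝ (Fin 2) := EuclideanSpace.single (0 : Fin 2) (1 : ℝ) with he₀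
  set c : ℝ := W x with hc
  -- the smooth kernel `G (r, s) = χ (t + r) ((x₁ + s) + r c, x₂)`
  set G : ℝ × ℝ → ℝ := fun q => Literature.Analysis.FunctionSpaces.Torus.stLift χ
    (t + q.1, Yx + (q.1 * c) • e₀ + q.2 • e₀) with hG
  have hGs : ContDiff ℝ ∞ G :=
    hχ.1.comp ((contDiff_const.add contDiff_fst).prodMk
      ((contDiff_const.add ((contDiff_fst.mul contDiff_const).smul contDiff_const)).add
        (contDiff_snd.smul contDiff_const)))
  -- the translated characteristic points
  have hpt : ∀ (s r : ℝ), (![(x + Literature.Analysis.FunctionSpaces.Torus.proj (s • e₀)) 0 +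
      ((r * W (x + Literature.Analysis.FunctionSpaces.Torus.proj (s • e₀)) : ℝ) : UnitAddCircle),
      (x + Literature.Analysis.FunctionSpaces.Torus.proj (s • e₀)) 1] : 𝕋²) =
      Literature.Analysis.FunctionSpaces.Torus.proj (Yx + (r * c) • e₀ + s • e₀) := by
    intro s r
    have hsingle : Literature.Analysis.FunctionSpaces.Torus.proj (s • e₀) = (Pi.single 0 ((s : ℝ) : UnitAddCircle) : 𝕋²) := by
      funext i; fin_cases i <;> simp [Literature.Analysis.FunctionSpaces.Torus.proj_apply, he₀]
    rw [hsingle, hWinv, ← hc, ← hsingle, ← skewPoint_add_proj x hYx c r s]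
    funext i; fin_cases i <;> simp [Literature.Analysis.FunctionSpaces.Torus.proj_apply, he₀, add_right_comm]
  have hGeq : ∀ r s, χ (t + r) ![(x + Literature.Analysis.FunctionSpaces.Torus.proj (s • e₀)) 0 +
      ((r * W (x + Literature.Analysis.FunctionSpaces.Torus.proj (s • e₀)) : ℝ) : UnitAddCircle),
      (x + Literature.Analysis.FunctionSpaces.Torus.proj (s • e₀)) 1] = G (r, s) := fun r s => by
    rw [hpt s r]; rfl
  -- the partial derivative as a line derivative of the parametric integral
  simp only [Literature.Analysis.FunctionSpaces.Torus.partialDeriv, Literature.Analysis.FunctionSpaces.Torus.lineDeriv]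
  rw [← he₀]
  simp_rw [hGeq]
  rw [show (fun s : ℝ => -∫ r in (0 : ℝ)..T, G (r, s)) = -(fun s : ℝ => ∫ r in (0 : ℝ)..T, G (r, s)) from rfl,
    deriv.neg, deriv_parametric_intervalIntegral hGs]
  congr 1
  refine intervalIntegral.integral_congr fun r _ => ?_
  -- `d/ds G(r, s)|₀` is the line derivative of `χ(t+r)` at the characteristic point along `e₀`
  have h : (fun s => G (r, s)) = fun s => χ (t + r)
      ((![x 0 + ((r * c : ℝ) : UnitAddCircle), x 1] : 𝕋²) + Literature.Analysis.FunctionSpaces.Torus.proj (s • e₀)) := by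
    funext s; rw [skewPoint_add_proj x hYx c r s]; rfl
  rw [h]

end DualDerivatives

/-! ## The dual test function solves the adjoint transport equation -/

section DualEquation

variable {T : ℝ} {χ : ℝ → 𝕋² → ℝ} {W : 𝕋² → ℝ}

/-- **The dual test function solves `∂ₜφ + W ∂₁φ = χ` on `t ≥ 0`** (for `W` independent of
`x₁` and `χ` vanishing for `t ≥ T' `, `T' < T`): the integrand of `∂ₜφ + W∂₁φ` is the
`r`-derivative of `χ(t + r, (x₁ + rW, x₂))`, whose integral over `[0,T]` is `-χ(t,x)` because
`χ(t + T, ·) = 0`. [folklore] -/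
theorem transport_dual (hχ : Literature.Analysis.FunctionSpaces.Torus.IsSpaceTimeTest T χ)
    (hWinv : ∀ (s : UnitAddCircle) (x : 𝕋²), W (x + Pi.single 0 s) = W x) {t : ℝ} (ht : 0 ≤ t) (x : 𝕋²) :
    Literature.Analysis.FunctionSpaces.Torus.timeDeriv (fun t x =>
        -∫ r in (0 : ℝ)..T, χ (t + r) ![x 0 + ((r * W x : ℝ) : UnitAddCircle), x 1]) t x +
      W x * Literature.Analysis.FunctionSpaces.Torus.partialDeriv 0 (fun x : 𝕋² =>
        -∫ r in (0 : ℝ)..T, χ (t + r) ![x 0 + ((r * W x : ℝ) : UnitAddCircle), x 1]) x = χ t x := by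
  obtain ⟨T', hT'T, hT'⟩ := hχ.2
  have hzero : χ (t + T) = 0 := hT' (t + T) (by linarith)
  rw [timeDeriv_dual hχ W t x, partialDeriv_dual hχ hWinv t x]
  have hq : Continuous fun r : ℝ => (![x 0 + ((r * W x : ℝ) : UnitAddCircle), x 1] : 𝕋²) := by
    refine continuous_pi fun i => ?_
    fin_cases i
    · show Continuous fun r : ℝ => x 0 + ((r * W x : ℝ) : UnitAddCircle)
      exact continuous_const.add ((AddCircle.continuous_mk' _).comp (continuous_id.mul continuous_const))
    · exact continuous_const
  have h1 : Continuous fun r : ℝ => Literature.Analysis.FunctionSpaces.Torus.timeDeriv χ (t + r)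
      ![x 0 + ((r * W x : ℝ) : UnitAddCircle), x 1] :=
    hχ.continuous_uncurry_timeDeriv.comp ((continuous_const.add continuous_id).prodMk hq)
  have h2 : Continuous fun r : ℝ => Literature.Analysis.FunctionSpaces.Torus.partialDeriv 0 (χ (t + r))
      ![x 0 + ((r * W x : ℝ) : UnitAddCircle), x 1] :=
    (hχ.continuous_uncurry_partialDeriv 0).comp ((continuous_const.add continuous_id).prodMk hq)
  have hsum := integral_deriv_test_comp_skew_shift hχ t (W x) x hzero
  rw [intervalIntegral.integral_add (h1.intervalIntegrable _ _) ((h2.const_mul _).intervalIntegrable _ _),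
    intervalIntegral.integral_const_mul] at hsum
  rw [mul_neg]
  linarith

/-- **A bound on `∂₁` of the dual test function, uniform in the coefficient `W`**: there is `K`
(depending on `χ` and `T ≥ 0` only) with `|∂₁φ(t,x)| ≤ K` for `t ∈ [0,T]`, every `x`, and every
`W` independent of `x₁` (`|∫₀ᵀ ∂₁χ(t+r, ·)| ≤ T sup_{[0,2T]×T²} |∂₁χ|`). [folklore] -/
theorem exists_bound_partialDeriv_dual (hχ : Literature.Analysis.FunctionSpaces.Torus.IsSpaceTimeTest T χ)
    (hT : 0 ≤ T) :
    ∃ K : ℝ, ∀ W : 𝕋² → ℝ, (∀ (s : UnitAddCircle) (x : 𝕋²), W (x + Pi.single 0 s) = W x) →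
      ∀ t ∈ Icc (0 : ℝ) T, ∀ x : 𝕋²,
        |Literature.Analysis.FunctionSpaces.Torus.partialDeriv 0 (fun x : 𝕋² =>
          -∫ r in (0 : ℝ)..T, χ (t + r) ![x 0 + ((r * W x : ℝ) : UnitAddCircle), x 1]) x| ≤ K := by
  obtain ⟨K₀, hK₀⟩ := Literature.Analysis.FunctionSpaces.Torus.exists_norm_le_of_continuousOn_of_isCompact
    (S := univ) ((hχ.isSmoothSpaceTimeOn univ).partialDeriv uniqueDiffOn_univ 0).continuousOn_stLift
    isCompact_Icc (subset_univ (Icc (0 : ℝ) (2 * T)))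
  refine ⟨K₀ * |T - 0|, fun W hWinv t ht x => ?_⟩
  rw [partialDeriv_dual hχ hWinv t x, abs_neg, ← Real.norm_eq_abs]
  refine intervalIntegral.norm_integral_le_of_norm_le_const fun r hr => ?_
  rw [uIoc_of_le hT] at hr
  exact hK₀ (t + r) ⟨by linarith [ht.1, hr.1], by linarith [ht.2, hr.2]⟩ _

end DualEquation

/-! ## Smooth truncations of the shear profile -/

section Truncation

variable {v : UnitAddCircle → ℝ}

/-- The Fourier truncations of `V(x) = v(x₂)` are independent of `x₁` (no modes `k₁ ≠ 0`:
`Torus.mFourierCoeff_eq_zero_of_forall_add_single` and `Torus.trigPoly_add_single`). [folklore] -/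
theorem scalarTruncate_shear_add_single (v : UnitAddCircle → ℝ) (N : ℕ) (s : UnitAddCircle) (x : 𝕋²) :
    Literature.Analysis.FunctionSpaces.Torus.scalarTruncate N (fun x : 𝕋² => v (x 1)) (x + Pi.single 0 s) =
      Literature.Analysis.FunctionSpaces.Torus.scalarTruncate N (fun x : 𝕋² => v (x 1)) x := by
  classical
  unfold Literature.Analysis.FunctionSpaces.Torus.scalarTruncate Literature.Analysis.FunctionSpaces.Torus.reTrigPoly
  simp only
  rw [Literature.Analysis.FunctionSpaces.Torus.trigPoly_add_single]
  intro k _ hk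
  exact Literature.Analysis.FunctionSpaces.Torus.mFourierCoeff_eq_zero_of_forall_add_single (i := 0)
    (fun s' y => by simp) hk

/-- `V(x) = v(x₂)` is in `L²(T²)` for `v ∈ L²(T)`. [folklore] -/
theorem memLp_shear_profile (hv : MemLp v 2 volume) : MemLp (fun x : 𝕋² => v (x 1)) 2 volume :=
  hv.comp_measurePreserving (measurePreserving_eval (fun _ : Fin 2 => (volume : Measure UnitAddCircle)) 1)

/-- **The truncations converge in `L²`**: `‖V - P_N V‖_{L²(T²)} → 0` (toReal form;
`Torus.tendsto_integral_sq_sub_scalarTruncate`). [folklore] -/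
theorem tendsto_toReal_eLpNorm_sub_scalarTruncate (hv : MemLp v 2 volume) :
    Tendsto (fun N => (eLpNorm ((fun x : 𝕋² => v (x 1)) -
      Literature.Analysis.FunctionSpaces.Torus.scalarTruncate N (fun x : 𝕋² => v (x 1))) 2 volume).toReal)
      atTop (𝓝 0) := by
  classical
  have hV := memLp_shear_profile hv
  have h := Literature.Analysis.FunctionSpaces.Torus.tendsto_integral_sq_sub_scalarTruncate hV
  have heq : ∀ N, (eLpNorm ((fun x : 𝕋² => v (x 1)) -
      Literature.Analysis.FunctionSpaces.Torus.scalarTruncate N (fun x : 𝕋² => v (x 1))) 2 volume).toReal =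
      (∫ x, ((fun x : 𝕋² => v (x 1)) x -
        Literature.Analysis.FunctionSpaces.Torus.scalarTruncate N (fun x : 𝕋² => v (x 1)) x) ^ 2) ^ (1 / 2 : ℝ) := by
    intro N
    have hd : MemLp ((fun x : 𝕋² => v (x 1)) -
        Literature.Analysis.FunctionSpaces.Torus.scalarTruncate N (fun x : 𝕋² => v (x 1))) 2 volume :=
      hV.sub (Literature.Analysis.FunctionSpaces.Torus.memLp_scalarTruncate N _ 2)
    rw [hd.eLpNorm_eq_integral_rpow_norm two_ne_zero ENNReal.ofNat_ne_top, ENNReal.toReal_ofReal (by positivity)]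
    simp only [ENNReal.toReal_ofNat, Pi.sub_apply, Real.norm_eq_abs, one_div]
    congr 1
    refine integral_congr_ae (Eventually.of_forall fun x => ?_)
    simp [sq_abs]
  simp_rw [heq]
  have h0 : (0 : ℝ) ^ (1 / 2 : ℝ) = 0 := Real.zero_rpow (by norm_num)
  rw [← h0]
  exact h.rpow_const (Or.inr (by norm_num))

end Truncation

/-! ## Weak solutions of the shear transport equation: integrability and the weak identity -/

section WeakFacts

variable {T : ℝ} {v : UnitAddCircle → ℝ} {θ₀ : 𝕋² → ℝ} {θ : ℝ → 𝕋² → ℝ}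

/-- The projection `(t, x) ↦ x₂` is quasi measure preserving from `μ ⊗ vol` to `vol`. [folklore] -/
theorem quasiMeasurePreserving_snd_one (μ : Measure ℝ) [SFinite μ] :
    Measure.QuasiMeasurePreserving (fun z : ℝ × 𝕋² => z.2 1) (μ.prod volume) volume :=
  (measurePreserving_eval (fun _ : Fin 2 => (volume : Measure UnitAddCircle)) 1).quasiMeasurePreserving.comp
    (Measure.quasiMeasurePreserving_snd (μ := μ) (ν := (volume : Measure 𝕋²)))

/-- A weak solution, uncurried, is a.e. strongly measurable and square integrable on
`(0,T) × T²`, with norm controlled by its `L^∞_t L²_x` bound. [folklore] -/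
theorem memLp_two_uncurry_of_isWeakScalarTransportOn
    (h : Literature.Analysis.FluidPDE.Torus.IsWeakScalarTransportOn T 0 (shearVelocity v) θ₀ θ) :
    AEStronglyMeasurable (uncurry θ) (((volume : Measure ℝ).restrict (Ioo 0 T)).prod (volume : Measure 𝕋²)) ∧
      MemLp (uncurry θ) 2 (((volume : Measure ℝ).restrict (Ioo 0 T)).prod (volume : Measure 𝕋²)) := by
  have hm := Literature.Analysis.FunctionSpaces.Torus.aestronglyMeasurable_uncurry_of_stLift_prod h.aestronglyMeasurable
  obtain ⟨C, hC⟩ := h.ae_lintegral_sq_le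
  have hfin : ∫⁻ t in Ioo 0 T, ∫⁻ x, ‖θ t x‖ₑ ^ 2 < ⊤ := by
    calc ∫⁻ t in Ioo 0 T, ∫⁻ x, ‖θ t x‖ₑ ^ 2 ≤ ∫⁻ _ in Ioo (0 : ℝ) T, (C : ℝ≥0∞) := lintegral_mono_ae hC
      _ < ⊤ := by
          rw [lintegral_const, Measure.restrict_apply_univ]
          exact ENNReal.mul_lt_top ENNReal.coe_lt_top measure_Ioo_lt_top
  exact ⟨hm, (Literature.Analysis.FunctionSpaces.Torus.memLp_two_uncurry hm hfin).1⟩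

/-- For a weak solution of the shear transport equation, `v(x₂) θ(t,x)` is integrable on
`(0,T) × T²` (the clause `u θ ∈ L¹` of `Torus.IsWeakScalarTransportOn`, `‖(v(x₂),0)‖ = |v(x₂)|`). [folklore] -/
theorem integrable_shear_mul_of_isWeakScalarTransportOn (hv : MemLp v 2 volume)
    (h : Literature.Analysis.FluidPDE.Torus.IsWeakScalarTransportOn T 0 (shearVelocity v) θ₀ θ) :
    Integrable (fun z : ℝ × 𝕋² => v (z.2 1) * θ z.1 z.2)
      (((volume : Measure ℝ).restrict (Ioo 0 T)).prod (volume : Measure 𝕋²)) := by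
  have hθm := (memLp_two_uncurry_of_isWeakScalarTransportOn h).1
  have hvm : AEStronglyMeasurable (fun z : ℝ × 𝕋² => v (z.2 1))
      (((volume : Measure ℝ).restrict (Ioo 0 T)).prod (volume : Measure 𝕋²)) :=
    hv.1.comp_quasiMeasurePreserving (quasiMeasurePreserving_snd_one _)
  have hm : AEStronglyMeasurable (fun z : ℝ × 𝕋² => v (z.2 1) * θ z.1 z.2)
      (((volume : Measure ℝ).restrict (Ioo 0 T)).prod (volume : Measure 𝕋²)) := hvm.mul hθm
  refine ⟨hm, ?_⟩
  have h1 := h.lintegral_mul_lt_top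
  have hu : ∀ t (x : 𝕋²), ‖shearVelocity v t x‖ₑ = ‖v (x 1)‖ₑ := fun t x => by
    rw [shearVelocity, enorm_vec2_zero]
  simp_rw [hu] at h1
  rw [hasFiniteIntegral_iff_enorm, lintegral_prod _ hm.aemeasurable.enorm]
  simp_rw [enorm_mul]
  exact h1

/-- **The weak identity in shear form**: for a weak solution of `∂ₜθ + v(x₂)∂₁θ = 0` with datum
`θ₀` and every space–time test `ψ`,
`∫₀ᵀ∫ θ (∂ₜψ + v(x₂)∂₁ψ) + ∫ θ₀ ψ(0) = 0` (`⟪(v,0), ∇ψ⟫ = v ∂₁ψ`). [folklore] -/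
theorem weak_eq_shear (h : Literature.Analysis.FluidPDE.Torus.IsWeakScalarTransportOn T 0 (shearVelocity v) θ₀ θ)
    {ψ : ℝ → 𝕋² → ℝ} (hψ : Literature.Analysis.FunctionSpaces.Torus.IsSpaceTimeTest T ψ) :
    (∫ t in Ioo 0 T, ∫ x, θ t x * (Literature.Analysis.FunctionSpaces.Torus.timeDeriv ψ t x +
        v (x 1) * Literature.Analysis.FunctionSpaces.Torus.partialDeriv 0 (ψ t) x)) +
      ∫ x, θ₀ x * ψ 0 x = 0 := by
  have hw := h.weak_eq ψ hψ
  have hpt : ∀ t x, Literature.Analysis.FunctionSpaces.Torus.timeDeriv ψ t x +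
      ⟪shearVelocity v t x, Literature.Analysis.FunctionSpaces.Torus.gradient (ψ t) x⟫ +
      0 * Literature.Analysis.FunctionSpaces.Torus.laplacian (ψ t) x =
      Literature.Analysis.FunctionSpaces.Torus.timeDeriv ψ t x +
        v (x 1) * Literature.Analysis.FunctionSpaces.Torus.partialDeriv 0 (ψ t) x := fun t x => by
    rw [inner_shearVelocity_gradient v ((hψ.isSmooth_slice t).isContDiff (by simp)), zero_mul, add_zero]
  simp_rw [hpt] at hw
  exact hw

/-- **Integrability of the tested weak solution on `(0,T) × T²`**: for a weak solution `θ`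
(`θ ∈ L²_{t,x}`, `vθ ∈ L¹`) and a space–time test `ψ` (bounded derivatives on `[0,T]`),
`θ (∂ₜψ + v(x₂)∂₁ψ)` is integrable for `(vol|_(0,T)) ⊗ vol`. [folklore] -/
theorem integrable_uncurry_mul_transport (hv : MemLp v 2 volume)
    (h : Literature.Analysis.FluidPDE.Torus.IsWeakScalarTransportOn T 0 (shearVelocity v) θ₀ θ)
    {ψ : ℝ → 𝕋² → ℝ} (hψ : Literature.Analysis.FunctionSpaces.Torus.IsSpaceTimeTest T ψ) :
    Integrable (uncurry fun t x => θ t x * (Literature.Analysis.FunctionSpaces.Torus.timeDeriv ψ t x +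
        v (x 1) * Literature.Analysis.FunctionSpaces.Torus.partialDeriv 0 (ψ t) x))
      (((volume : Measure ℝ).restrict (Ioo 0 T)).prod (volume : Measure 𝕋²)) := by
  obtain ⟨hθm, hθL⟩ := memLp_two_uncurry_of_isWeakScalarTransportOn h
  have hθi : Integrable (uncurry θ) (((volume : Measure ℝ).restrict (Ioo 0 T)).prod (volume : Measure 𝕋²)) :=
    hθL.integrable one_le_two
  have hVθ := integrable_shear_mul_of_isWeakScalarTransportOn hv h
  -- bounds on the test derivatives on `[0,T]`
  obtain ⟨K₁, hK₁⟩ := Literature.Analysis.FunctionSpaces.Torus.exists_norm_le_of_continuousOn_of_isCompact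
    (S := univ) hψ.timeDeriv.1.continuous.continuousOn isCompact_Icc (subset_univ (Icc (0 : ℝ) T))
  obtain ⟨K₂, hK₂⟩ := Literature.Analysis.FunctionSpaces.Torus.exists_norm_le_of_continuousOn_of_isCompact
    (S := univ) ((hψ.isSmoothSpaceTimeOn univ).partialDeriv uniqueDiffOn_univ 0).continuousOn_stLift
    isCompact_Icc (subset_univ (Icc (0 : ℝ) T))
  have hae : ∀ᵐ z ∂(((volume : Measure ℝ).restrict (Ioo 0 T)).prod (volume : Measure 𝕋²)), z.1 ∈ Ioo 0 T :=
    (Measure.quasiMeasurePreserving_fst (μ := (volume : Measure ℝ).restrict (Ioo 0 T))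
      (ν := (volume : Measure 𝕋²))).ae (ae_restrict_mem measurableSet_Ioo)
  have hm1 : AEStronglyMeasurable (fun z : ℝ × 𝕋² => Literature.Analysis.FunctionSpaces.Torus.timeDeriv ψ z.1 z.2)
      (((volume : Measure ℝ).restrict (Ioo 0 T)).prod (volume : Measure 𝕋²)) :=
    hψ.continuous_uncurry_timeDeriv.aestronglyMeasurable
  have hm2 : AEStronglyMeasurable (fun z : ℝ × 𝕋² => Literature.Analysis.FunctionSpaces.Torus.partialDeriv 0 (ψ z.1) z.2)
      (((volume : Measure ℝ).restrict (Ioo 0 T)).prod (volume : Measure 𝕋²)) :=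
    (hψ.continuous_uncurry_partialDeriv 0).aestronglyMeasurable
  have i1 : Integrable (fun z : ℝ × 𝕋² => Literature.Analysis.FunctionSpaces.Torus.timeDeriv ψ z.1 z.2 * uncurry θ z)
      (((volume : Measure ℝ).restrict (Ioo 0 T)).prod (volume : Measure 𝕋²)) :=
    hθi.bdd_mul hm1 (hae.mono fun z hz => hK₁ _ (Ioo_subset_Icc_self hz) _)
  have i2 : Integrable (fun z : ℝ × 𝕋² => Literature.Analysis.FunctionSpaces.Torus.partialDeriv 0 (ψ z.1) z.2 *
        (v (z.2 1) * θ z.1 z.2))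
      (((volume : Measure ℝ).restrict (Ioo 0 T)).prod (volume : Measure 𝕋²)) :=
    hVθ.bdd_mul hm2 (hae.mono fun z hz => hK₂ _ (Ioo_subset_Icc_self hz) _)
  refine (i1.add i2).congr (Eventually.of_forall fun z => ?_)
  obtain ⟨t, x⟩ := z
  simp only [uncurry_apply_pair, Pi.add_apply]
  ring

/-- **The difference of two weak solutions with the same datum is orthogonal to all transport
tests**: `∫₀ᵀ∫ (θ - θ')(∂ₜψ + v(x₂)∂₁ψ) = 0` for every space–time test `ψ` on `T² × [0,T)`. [folklore] -/
theorem setIntegral_integral_sub_mul_transport_eq_zero (hv : MemLp v 2 volume) {θ' : ℝ → 𝕋² → ℝ}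
    (h : Literature.Analysis.FluidPDE.Torus.IsWeakScalarTransportOn T 0 (shearVelocity v) θ₀ θ)
    (h' : Literature.Analysis.FluidPDE.Torus.IsWeakScalarTransportOn T 0 (shearVelocity v) θ₀ θ')
    {ψ : ℝ → 𝕋² → ℝ} (hψ : Literature.Analysis.FunctionSpaces.Torus.IsSpaceTimeTest T ψ) :
    ∫ t in Ioo 0 T, ∫ x, (θ t x - θ' t x) * (Literature.Analysis.FunctionSpaces.Torus.timeDeriv ψ t x +
        v (x 1) * Literature.Analysis.FunctionSpaces.Torus.partialDeriv 0 (ψ t) x) = 0 := by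
  have e1 := weak_eq_shear h hψ
  have e2 := weak_eq_shear h' hψ
  have i1 := integrable_uncurry_mul_transport hv h hψ
  have i2 := integrable_uncurry_mul_transport hv h' hψ
  simp_rw [sub_mul]
  have hsub := integral_integral_sub i1 i2
  simp only [uncurry_apply_pair] at hsub
  rw [hsub]
  linarith

end WeakFacts

/-! ## The duality argument: the difference is orthogonal to every test -/

section Duality

variable {T : ℝ} {v : UnitAddCircle → ℝ} {θ₀ : 𝕋² → ℝ} {θ θ' : ℝ → 𝕋² → ℝ}

/-- Slices of a weak solution are in `L²` with norm at most `√C`, for a.e. time. [folklore] -/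
theorem ae_eLpNorm_slice_le (h : Literature.Analysis.FluidPDE.Torus.IsWeakScalarTransportOn T 0 (shearVelocity v) θ₀ θ) :
    ∃ C : ℝ≥0, ∀ᵐ t ∂((volume : Measure ℝ).restrict (Ioo 0 T)),
      MemLp (θ t) 2 volume ∧ eLpNorm (θ t) 2 volume ≤ (C : ℝ≥0∞) ^ (1 / 2 : ℝ) := by
  obtain ⟨C, hC⟩ := h.ae_lintegral_sq_le
  have hm := (memLp_two_uncurry_of_isWeakScalarTransportOn h).1
  have hslice : ∀ᵐ t ∂((volume : Measure ℝ).restrict (Ioo 0 T)), AEStronglyMeasurable (θ t) volume :=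
    hm.prodMk_left
  refine ⟨C, ?_⟩
  filter_upwards [hC, hslice] with t ht hmt
  have heq : eLpNorm (θ t) 2 volume = (∫⁻ x, ‖θ t x‖ₑ ^ 2) ^ (1 / 2 : ℝ) := by
    rw [Literature.Analysis.FunctionSpaces.eLpNorm_two_eq_pow_two_rpow_half,
      Literature.Analysis.FunctionSpaces.eLpNorm_two_pow_two_eq_lintegral]
  have hle : eLpNorm (θ t) 2 volume ≤ (C : ℝ≥0∞) ^ (1 / 2 : ℝ) := by
    rw [heq]; exact ENNReal.rpow_le_rpow ht (by norm_num)
  exact ⟨⟨hmt, hle.trans_lt (ENNReal.rpow_lt_top_of_nonneg (by norm_num) ENNReal.coe_ne_top)⟩, hle⟩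

/-- **Duality: the difference of two weak solutions with the same datum is orthogonal to every
space–time test function** (Bardos–Titi–Wiedemann 2012, Lemma 4, uniqueness — "elementary"):
`∫₀ᵀ∫ (θ - θ')χ = 0` for every test `χ` on `T² × [0,T)`, `T > 0`. Proof: with the smooth
truncations `V_N` of `V(x) = v(x₂)` (independent of `x₁`), the dual tests
`φ_N(t,x) = -∫₀ᵀ χ(t+r, (x₁ + rV_N(x), x₂)) dr` solve `∂ₜφ_N + V_N∂₁φ_N = χ` on `(0,T)`, so the
difference identity tested with `φ_N` reads `∫∫(θ-θ')χ = -∫∫(θ-θ')(V - V_N)∂₁φ_N`, which is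
`≤ K T ‖θ-θ'‖_{L^∞L²} ‖V - V_N‖_{L²} → 0`, the bound `K` on `∂₁φ_N` being uniform in `N`. [cite: BardosTitiWiedemann2012, Lemma 4] -/
theorem setIntegral_integral_sub_mul_test_eq_zero (hv : MemLp v 2 volume) (hT : 0 < T)
    (h : Literature.Analysis.FluidPDE.Torus.IsWeakScalarTransportOn T 0 (shearVelocity v) θ₀ θ)
    (h' : Literature.Analysis.FluidPDE.Torus.IsWeakScalarTransportOn T 0 (shearVelocity v) θ₀ θ')
    {χ : ℝ → 𝕋² → ℝ} (hχ : Literature.Analysis.FunctionSpaces.Torus.IsSpaceTimeTest T χ) :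
    ∫ t in Ioo 0 T, ∫ x, (θ t x - θ' t x) * χ t x = 0 := by
  classical
  -- facts about the difference `δ = θ - θ'` on `(0,T) × T²`
  obtain ⟨hθm, hθL⟩ := memLp_two_uncurry_of_isWeakScalarTransportOn h
  obtain ⟨hθm', hθL'⟩ := memLp_two_uncurry_of_isWeakScalarTransportOn h'
  have hδm : AEStronglyMeasurable (fun z : ℝ × 𝕋² => θ z.1 z.2 - θ' z.1 z.2)
      (((volume : Measure ℝ).restrict (Ioo 0 T)).prod (volume : Measure 𝕋²)) := hθm.sub hθm'
  have hδi : Integrable (fun z : ℝ × 𝕋² => θ z.1 z.2 - θ' z.1 z.2)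
      (((volume : Measure ℝ).restrict (Ioo 0 T)).prod (volume : Measure 𝕋²)) :=
    (hθL.integrable one_le_two).sub (hθL'.integrable one_le_two)
  have hVδ : Integrable (fun z : ℝ × 𝕋² => v (z.2 1) * (θ z.1 z.2 - θ' z.1 z.2))
      (((volume : Measure ℝ).restrict (Ioo 0 T)).prod (volume : Measure 𝕋²)) := by
    refine ((integrable_shear_mul_of_isWeakScalarTransportOn hv h).sub
      (integrable_shear_mul_of_isWeakScalarTransportOn hv h')).congr (Eventually.of_forall fun z => ?_)
    simp only [Pi.sub_apply]; ring
  obtain ⟨C, hC⟩ := ae_eLpNorm_slice_le h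
  obtain ⟨C', hC'⟩ := ae_eLpNorm_slice_le h'
  set M : ℝ≥0∞ := (C : ℝ≥0∞) ^ (1 / 2 : ℝ) + (C' : ℝ≥0∞) ^ (1 / 2 : ℝ) with hMdef
  have hMfin : M ≠ ⊤ := ENNReal.add_ne_top.2 ⟨ENNReal.rpow_ne_top_of_nonneg (by norm_num) ENNReal.coe_ne_top,
    ENNReal.rpow_ne_top_of_nonneg (by norm_num) ENNReal.coe_ne_top⟩
  have hM : ∀ᵐ t ∂((volume : Measure ℝ).restrict (Ioo 0 T)),
      MemLp (fun x => θ t x - θ' t x) 2 volume ∧ eLpNorm (fun x => θ t x - θ' t x) 2 volume ≤ M := by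
    filter_upwards [hC, hC'] with t ht ht'
    refine ⟨ht.1.sub ht'.1, ?_⟩
    calc eLpNorm (fun x => θ t x - θ' t x) 2 volume = eLpNorm (θ t - θ' t) 2 volume := rfl
      _ ≤ eLpNorm (θ t) 2 volume + eLpNorm (θ' t) 2 volume := eLpNorm_sub_le ht.1.1 ht'.1.1 one_le_two
      _ ≤ M := add_le_add ht.2 ht'.2
  -- bounds on the test and on `∂₁` of the dual tests, uniformly in the coefficient
  obtain ⟨Kχ, hKχ⟩ := Literature.Analysis.FunctionSpaces.Torus.exists_norm_le_of_continuousOn_of_isCompact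
    (S := univ) hχ.1.continuous.continuousOn isCompact_Icc (subset_univ (Icc (0 : ℝ) T))
  obtain ⟨K, hK⟩ := exists_bound_partialDeriv_dual hχ hT.le
  have hK0 : 0 ≤ K := (abs_nonneg _).trans (hK (fun _ => 0) (fun _ _ => rfl) 0 ⟨le_rfl, hT.le⟩ 0)
  have hae : ∀ᵐ z ∂(((volume : Measure ℝ).restrict (Ioo 0 T)).prod (volume : Measure 𝕋²)), z.1 ∈ Ioo 0 T :=
    (Measure.quasiMeasurePreserving_fst (μ := (volume : Measure ℝ).restrict (Ioo 0 T))
      (ν := (volume : Measure 𝕋²))).ae (ae_restrict_mem measurableSet_Ioo)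
  -- the truncations of `V(x) = v(x₂)`
  set V : 𝕋² → ℝ := fun x => v (x 1) with hVdef
  set VN : ℕ → 𝕋² → ℝ := fun N => Literature.Analysis.FunctionSpaces.Torus.scalarTruncate N V with hVNdef
  have hVNs : ∀ N, Literature.Analysis.FunctionSpaces.Torus.IsSmooth (VN N) := fun N =>
    Literature.Analysis.FunctionSpaces.Torus.isSmooth_scalarTruncate N V
  have hVNinv : ∀ N (s : UnitAddCircle) (x : 𝕋²), VN N (x + Pi.single 0 s) = VN N x := fun N s x =>
    scalarTruncate_shear_add_single v N s x
  have heN := tendsto_toReal_eLpNorm_sub_scalarTruncate (v := v) hv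
  have hVL : MemLp V 2 volume := memLp_shear_profile hv
  -- `A := ∫∫ δ χ` and its integrability
  have hχm : AEStronglyMeasurable (fun z : ℝ × 𝕋² => χ z.1 z.2)
      (((volume : Measure ℝ).restrict (Ioo 0 T)).prod (volume : Measure 𝕋²)) :=
    (Literature.Analysis.FunctionSpaces.Torus.continuous_uncurry_of_continuous_stLift hχ.1.continuous).aestronglyMeasurable
  have hAi : Integrable (fun z : ℝ × 𝕋² => (θ z.1 z.2 - θ' z.1 z.2) * χ z.1 z.2)
      (((volume : Measure ℝ).restrict (Ioo 0 T)).prod (volume : Measure 𝕋²)) := by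
    refine (hδi.bdd_mul hχm (hae.mono fun z hz => hKχ _ (Ioo_subset_Icc_self hz) _)).congr
      (Eventually.of_forall fun z => ?_)
    ring
  -- the bound `|A| ≤ K · E_N` for every `N`
  have hbound : ∀ N, |∫ t in Ioo 0 T, ∫ x, (θ t x - θ' t x) * χ t x| ≤
      K * ((volume (Ioo (0 : ℝ) T)).toReal * (M.toReal * (eLpNorm (V - VN N) 2 volume).toReal)) := by
    intro N
    -- the dual test and its properties
    have hφ := isSpaceTimeTest_dual hχ hT.le (hVNs N)
    have htr : ∀ t, 0 ≤ t → ∀ x, Literature.Analysis.FunctionSpaces.Torus.timeDeriv (fun t x =>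
        -∫ r in (0 : ℝ)..T, χ (t + r) ![x 0 + ((r * VN N x : ℝ) : UnitAddCircle), x 1]) t x +
        V x * Literature.Analysis.FunctionSpaces.Torus.partialDeriv 0 (fun x : 𝕋² =>
          -∫ r in (0 : ℝ)..T, χ (t + r) ![x 0 + ((r * VN N x : ℝ) : UnitAddCircle), x 1]) x =
        χ t x + (V x - VN N x) * Literature.Analysis.FunctionSpaces.Torus.partialDeriv 0 (fun x : 𝕋² =>
          -∫ r in (0 : ℝ)..T, χ (t + r) ![x 0 + ((r * VN N x : ℝ) : UnitAddCircle), x 1]) x := by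
      intro t ht x
      have h1 := transport_dual hχ (hVNinv N) ht x
      rw [← h1]
      ring
    -- the difference identity with the dual test, rewritten on `(0,T)`
    have hid := setIntegral_integral_sub_mul_transport_eq_zero hv h h' hφ
    have hcongr : ∫ t in Ioo 0 T, ∫ x, (θ t x - θ' t x) * (Literature.Analysis.FunctionSpaces.Torus.timeDeriv (fun t x =>
        -∫ r in (0 : ℝ)..T, χ (t + r) ![x 0 + ((r * VN N x : ℝ) : UnitAddCircle), x 1]) t x +
        v (x 1) * Literature.Analysis.FunctionSpaces.Torus.partialDeriv 0 (fun x : 𝕋² =>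
          -∫ r in (0 : ℝ)..T, χ (t + r) ![x 0 + ((r * VN N x : ℝ) : UnitAddCircle), x 1]) x) =
        ∫ t in Ioo 0 T, ∫ x, ((θ t x - θ' t x) * χ t x +
          (θ t x - θ' t x) * ((V x - VN N x) * Literature.Analysis.FunctionSpaces.Torus.partialDeriv 0 (fun x : 𝕋² =>
            -∫ r in (0 : ℝ)..T, χ (t + r) ![x 0 + ((r * VN N x : ℝ) : UnitAddCircle), x 1]) x)) := by
      refine setIntegral_congr_fun measurableSet_Ioo fun t ht => ?_
      refine integral_congr_ae (Eventually.of_forall fun x => ?_)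
      beta_reduce
      rw [show v (x 1) = V x from rfl, htr t ht.1.le x]
      ring
    rw [hcongr] at hid
    -- integrability of the two parts, and splitting
    have hpm : AEStronglyMeasurable (fun z : ℝ × 𝕋² => Literature.Analysis.FunctionSpaces.Torus.partialDeriv 0 (fun x : 𝕋² =>
        -∫ r in (0 : ℝ)..T, χ (z.1 + r) ![x 0 + ((r * VN N x : ℝ) : UnitAddCircle), x 1]) z.2)
        (((volume : Measure ℝ).restrict (Ioo 0 T)).prod (volume : Measure 𝕋²)) :=
      (hφ.continuous_uncurry_partialDeriv 0).aestronglyMeasurable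
    obtain ⟨B, hB⟩ : ∃ B, ∀ x, ‖VN N x‖ ≤ B := by
      obtain ⟨B, hB⟩ := isCompact_univ.exists_bound_of_continuousOn (hVNs N).continuous.continuousOn
      exact ⟨B, fun x => hB x (mem_univ x)⟩
    have hVNm : AEStronglyMeasurable (fun z : ℝ × 𝕋² => VN N z.2)
        (((volume : Measure ℝ).restrict (Ioo 0 T)).prod (volume : Measure 𝕋²)) :=
      ((hVNs N).continuous.comp continuous_snd).aestronglyMeasurable
    have hWi : Integrable (fun z : ℝ × 𝕋² => (V z.2 - VN N z.2) * (θ z.1 z.2 - θ' z.1 z.2))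
        (((volume : Measure ℝ).restrict (Ioo 0 T)).prod (volume : Measure 𝕋²)) := by
      refine (hVδ.sub (hδi.bdd_mul hVNm (Eventually.of_forall fun z => hB z.2))).congr
        (Eventually.of_forall fun z => ?_)
      simp only [Pi.sub_apply, hVdef]; ring
    have hBi : Integrable (fun z : ℝ × 𝕋² => (θ z.1 z.2 - θ' z.1 z.2) * ((V z.2 - VN N z.2) *
        Literature.Analysis.FunctionSpaces.Torus.partialDeriv 0 (fun x : 𝕋² =>
          -∫ r in (0 : ℝ)..T, χ (z.1 + r) ![x 0 + ((r * VN N x : ℝ) : UnitAddCircle), x 1]) z.2))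
        (((volume : Measure ℝ).restrict (Ioo 0 T)).prod (volume : Measure 𝕋²)) := by
      refine (hWi.bdd_mul (c := K) hpm (hae.mono fun z hz => ?_)).congr (Eventually.of_forall fun z => by ring)
      rw [Real.norm_eq_abs]
      exact hK (VN N) (hVNinv N) z.1 (Ioo_subset_Icc_self hz) z.2
    have hsplit := integral_integral_add hAi hBi
    simp only at hsplit
    rw [hsplit] at hid
    -- `A = -B_N` and `|B_N| ≤ K E_N`
    have hA : ∫ t in Ioo 0 T, ∫ x, (θ t x - θ' t x) * χ t x =
        -∫ t in Ioo 0 T, ∫ x, (θ t x - θ' t x) * ((V x - VN N x) *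
          Literature.Analysis.FunctionSpaces.Torus.partialDeriv 0 (fun x : 𝕋² =>
            -∫ r in (0 : ℝ)..T, χ (t + r) ![x 0 + ((r * VN N x : ℝ) : UnitAddCircle), x 1]) x) := by
      linarith
    rw [hA, abs_neg, ← integral_prod _ hBi]
    -- pointwise bound on the product space
    have hpt : ∀ᵐ z ∂(((volume : Measure ℝ).restrict (Ioo 0 T)).prod (volume : Measure 𝕋²)),
        ‖(θ z.1 z.2 - θ' z.1 z.2) * ((V z.2 - VN N z.2) *
          Literature.Analysis.FunctionSpaces.Torus.partialDeriv 0 (fun x : 𝕋² =>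
            -∫ r in (0 : ℝ)..T, χ (z.1 + r) ![x 0 + ((r * VN N x : ℝ) : UnitAddCircle), x 1]) z.2)‖ ≤
        K * (|θ z.1 z.2 - θ' z.1 z.2| * |V z.2 - VN N z.2|) := by
      filter_upwards [hae] with z hz
      rw [Real.norm_eq_abs, abs_mul, abs_mul]
      have hk := hK (VN N) (hVNinv N) z.1 (Ioo_subset_Icc_self hz) z.2
      have h0 : 0 ≤ |θ z.1 z.2 - θ' z.1 z.2| * |V z.2 - VN N z.2| := mul_nonneg (abs_nonneg _) (abs_nonneg _)
      nlinarith
    have hEi : Integrable (fun z : ℝ × 𝕋² => |θ z.1 z.2 - θ' z.1 z.2| * |V z.2 - VN N z.2|)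
        (((volume : Measure ℝ).restrict (Ioo 0 T)).prod (volume : Measure 𝕋²)) := by
      refine hWi.abs.congr (Eventually.of_forall fun z => ?_)
      show |(V z.2 - VN N z.2) * (θ z.1 z.2 - θ' z.1 z.2)| = _
      rw [abs_mul, mul_comm]
    -- slicewise Cauchy–Schwarz, integrated in time
    have hEN : ∫ z, |θ z.1 z.2 - θ' z.1 z.2| * |V z.2 - VN N z.2|
        ∂(((volume : Measure ℝ).restrict (Ioo 0 T)).prod (volume : Measure 𝕋²)) ≤
        (volume (Ioo (0 : ℝ) T)).toReal * (M.toReal * (eLpNorm (V - VN N) 2 volume).toReal) := by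
      rw [integral_prod _ hEi]
      have hdN : MemLp (V - VN N) 2 volume := hVL.sub (Literature.Analysis.FunctionSpaces.Torus.memLp_scalarTruncate N V 2)
      have hslice : ∀ᵐ t ∂((volume : Measure ℝ).restrict (Ioo 0 T)),
          ∫ x, |θ t x - θ' t x| * |V x - VN N x| ≤ M.toReal * (eLpNorm (V - VN N) 2 volume).toReal := by
        filter_upwards [hM] with t ht
        have h1 := abs_integral_mul_le_toReal (A := fun x => |θ t x - θ' t x|) (r := fun x => |V x - VN N x|)
          ht.1.abs hdN.abs
        have hn1 : eLpNorm (fun x => |θ t x - θ' t x|) 2 volume = eLpNorm (fun x => θ t x - θ' t x) 2 volume := by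
          simp_rw [← Real.norm_eq_abs]; exact eLpNorm_norm _
        have hn2 : eLpNorm (fun x => |V x - VN N x|) 2 volume = eLpNorm (V - VN N) 2 volume := by
          simp_rw [← Real.norm_eq_abs]; exact eLpNorm_norm (V - VN N)
        rw [hn1, hn2] at h1
        have hfin : M * eLpNorm (V - VN N) 2 volume ≠ ⊤ := ENNReal.mul_ne_top hMfin hdN.eLpNorm_ne_top
        calc ∫ x, |θ t x - θ' t x| * |V x - VN N x|
            ≤ |(∫ x, |θ t x - θ' t x| * |V x - VN N x|)| := le_abs_self _
          _ ≤ (eLpNorm (fun x => θ t x - θ' t x) 2 volume * eLpNorm (V - VN N) 2 volume).toReal := h1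
          _ ≤ (M * eLpNorm (V - VN N) 2 volume).toReal := ENNReal.toReal_mono hfin (by gcongr; exact ht.2)
          _ = M.toReal * (eLpNorm (V - VN N) 2 volume).toReal := ENNReal.toReal_mul
      calc ∫ t in Ioo 0 T, ∫ x, |θ t x - θ' t x| * |V x - VN N x|
          ≤ ∫ _ in Ioo (0 : ℝ) T, M.toReal * (eLpNorm (V - VN N) 2 volume).toReal :=
            integral_mono_ae hEi.integral_prod_left (integrable_const _) hslice
        _ = (volume (Ioo (0 : ℝ) T)).toReal * (M.toReal * (eLpNorm (V - VN N) 2 volume).toReal) := by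
            rw [setIntegral_const, smul_eq_mul]
            rfl
    calc |∫ z, (θ z.1 z.2 - θ' z.1 z.2) * ((V z.2 - VN N z.2) *
          Literature.Analysis.FunctionSpaces.Torus.partialDeriv 0 (fun x : 𝕋² =>
            -∫ r in (0 : ℝ)..T, χ (z.1 + r) ![x 0 + ((r * VN N x : ℝ) : UnitAddCircle), x 1]) z.2)
          ∂(((volume : Measure ℝ).restrict (Ioo 0 T)).prod (volume : Measure 𝕋²))|
        ≤ ∫ z, K * (|θ z.1 z.2 - θ' z.1 z.2| * |V z.2 - VN N z.2|)
          ∂(((volume : Measure ℝ).restrict (Ioo 0 T)).prod (volume : Measure 𝕋²)) := by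
          refine (MeasureTheory.abs_integral_le_integral_abs).trans (integral_mono_ae hBi.abs (hEi.const_mul K) ?_)
          filter_upwards [hpt] with z hz
          rwa [Real.norm_eq_abs] at hz
      _ = K * ∫ z, |θ z.1 z.2 - θ' z.1 z.2| * |V z.2 - VN N z.2|
          ∂(((volume : Measure ℝ).restrict (Ioo 0 T)).prod (volume : Measure 𝕋²)) := integral_const_mul _ _
      _ ≤ K * ((volume (Ioo (0 : ℝ) T)).toReal * (M.toReal * (eLpNorm (V - VN N) 2 volume).toReal)) :=
          mul_le_mul_of_nonneg_left hEN hK0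
  -- let `N → ∞`
  have hlim : Tendsto (fun N => K * ((volume (Ioo (0 : ℝ) T)).toReal * (M.toReal * (eLpNorm (V - VN N) 2 volume).toReal)))
      atTop (𝓝 0) := by
    have := ((heN.const_mul M.toReal).const_mul (volume (Ioo (0 : ℝ) T)).toReal).const_mul K
    simpa using this
  have habs : |∫ t in Ioo 0 T, ∫ x, (θ t x - θ' t x) * χ t x| ≤ 0 :=
    le_of_tendsto_of_tendsto' tendsto_const_nhds hlim hbound
  exact abs_nonpos_iff.1 habs

end Duality

/-! ## Uniqueness: from orthogonality to all tests to `θ = θ'` -/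

section Unique

variable {T : ℝ} {v : UnitAddCircle → ℝ} {θ₀ : 𝕋² → ℝ} {θ θ' : ℝ → 𝕋² → ℝ}

/-- A smooth cutoff equal to `1` on `[-1, ∞)` and to `0` on `(-∞, -2]` (for making time tests
compactly supported without changing them on `[0, ∞)`). [folklore] -/
theorem exists_cutoff_eq_one_on_Ici : ∃ χ : ℝ → ℝ, ContDiff ℝ ∞ χ ∧ (∀ t, -1 ≤ t → χ t = 1) ∧ (∀ t, t ≤ -2 → χ t = 0) := by
  refine ⟨fun t => Real.smoothTransition (t + 2), ?_, fun t ht => ?_, fun t ht => ?_⟩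
  · exact Real.smoothTransition.contDiff.comp (contDiff_id.add contDiff_const)
  · exact Real.smoothTransition.one_of_one_le (by linarith)
  · exact Real.smoothTransition.zero_of_nonpos (by linarith)

/-- **Bardos–Titi–Wiedemann 2012, Lemma 4, uniqueness — proved.** Two weak solutions of
`∂ₜw + v(x₂)∂₁w = 0` in `L^∞(0,T;L²(T²))` with the same datum agree a.e. on a.e. time slice of
`(0,T)` (`T > 0`, `v ∈ L²(T)`): by `setIntegral_integral_sub_mul_test_eq_zero` their difference
`δ` is orthogonal to every test; testing with `η'(t) g(x)` and the weak ODE lemma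
`Literature.Analysis.FunctionSpaces.ae_eq_exp_smul_of_forall_integral_deriv_sub` (`λ = 0`) gives
`∫ δ(t) g = 0` for a.e. `t`, for every smooth `g`; over the countable family `Re(z e_{-k})` all
Fourier coefficients of `δ(t)` vanish, so `δ(t) = 0` by Parseval. [cite: BardosTitiWiedemann2012, Lemma 4] -/
theorem ae_ae_eq_of_isWeakScalarTransportOn (hv : MemLp v 2 volume) (hT : 0 < T)
    (h : Literature.Analysis.FluidPDE.Torus.IsWeakScalarTransportOn T 0 (shearVelocity v) θ₀ θ)
    (h' : Literature.Analysis.FluidPDE.Torus.IsWeakScalarTransportOn T 0 (shearVelocity v) θ₀ θ') :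
    ∀ᵐ t ∂((volume : Measure ℝ).restrict (Ioo 0 T)), θ t =ᵐ[volume] θ' t := by
  classical
  obtain ⟨hθm, hθL⟩ := memLp_two_uncurry_of_isWeakScalarTransportOn h
  obtain ⟨hθm', hθL'⟩ := memLp_two_uncurry_of_isWeakScalarTransportOn h'
  have hδi : Integrable (fun z : ℝ × 𝕋² => θ z.1 z.2 - θ' z.1 z.2)
      (((volume : Measure ℝ).restrict (Ioo 0 T)).prod (volume : Measure 𝕋²)) :=
    (hθL.integrable one_le_two).sub (hθL'.integrable one_le_two)
  -- Step 1: `∫ δ(t) g = 0` for a.e. `t`, for every smooth `g`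
  have hstep : ∀ g : 𝕋² → ℝ, Literature.Analysis.FunctionSpaces.Torus.IsSmooth g →
      ∀ᵐ t ∂((volume : Measure ℝ).restrict (Ioo 0 T)), ∫ x, (θ t x - θ' t x) * g x = 0 := by
    intro g hg
    obtain ⟨B, hB⟩ : ∃ B, ∀ x, ‖g x‖ ≤ B := by
      obtain ⟨B, hB⟩ := isCompact_univ.exists_bound_of_continuousOn hg.continuous.continuousOn
      exact ⟨B, fun x => hB x (mem_univ x)⟩
    have hgi : Integrable (fun z : ℝ × 𝕋² => (θ z.1 z.2 - θ' z.1 z.2) * g z.2)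
        (((volume : Measure ℝ).restrict (Ioo 0 T)).prod (volume : Measure 𝕋²)) := by
      refine (hδi.bdd_mul (c := B) ((hg.continuous.comp continuous_snd).aestronglyMeasurable)
        (Eventually.of_forall fun z => hB z.2)).congr (Eventually.of_forall fun z => by
          simp only [Function.comp_apply]; ring)
    set F : ℝ → ℝ := fun t => ∫ x, (θ t x - θ' t x) * g x with hF
    have hFint : IntegrableOn F (Ioo 0 T) volume := hgi.integral_prod_left
    obtain ⟨cut, hcut, hcut1, hcut0⟩ := exists_cutoff_eq_one_on_Ici
    have key : ∀ ρ : ℝ → ℝ, ContDiff ℝ ∞ ρ → (∃ T' < T, ∀ t, T' ≤ t → ρ t = 0) →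
        (∫ t in Ioo 0 T, (deriv ρ t - 0 * ρ t) • F t) + ρ 0 • (0 : ℝ) = 0 := by
      intro ρ hρ ⟨T', hT'T, hT'⟩
      set η : ℝ → ℝ := fun t => ρ t * cut t with hη
      have hηs : ContDiff ℝ ∞ η := hρ.mul hcut
      have hηK : ∀ t, t ∉ Icc (-2 : ℝ) T' → η t = 0 := by
        intro t ht
        simp only [mem_Icc, not_and_or, not_le] at ht
        rcases ht with ht | ht
        · simp [hη, hcut0 t ht.le]
        · simp [hη, hT' t ht.le]
      have hηc : HasCompactSupport η := HasCompactSupport.intro isCompact_Icc hηK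
      have hηsupp : tsupport η ⊆ Icc (-2 : ℝ) T' :=
        closure_minimal (fun t ht => by_contra fun h => ht (hηK t h)) isClosed_Icc
      -- the time test `η'` and the space–time test `η'(t) g(x)`
      have hdηs : ContDiff ℝ ∞ (deriv η) := (contDiff_infty_iff_deriv.1 hηs).2
      have hdηc : HasCompactSupport (deriv η) := hηc.deriv
      have hdηT : tsupport (deriv η) ⊆ Iio T :=
        ((closure_minimal support_deriv_subset (isClosed_tsupport η)).trans hηsupp).trans
          fun t ht => lt_of_le_of_lt ht.2 hT'T
      have hχ := Literature.Analysis.FluidPDE.Torus.isSpaceTimeTest_mul hdηs hdηc hdηT hg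
      have hU4 := setIntegral_integral_sub_mul_test_eq_zero hv hT h h' hχ
      -- `η' = ρ'` on `(0,T)`
      have hηρ : ∀ t, -1 < t → η t = ρ t := fun t ht => by simp [hη, hcut1 t ht.le]
      have hderiv : ∀ t, -1 < t → deriv η t = deriv ρ t := fun t ht => by
        refine Filter.EventuallyEq.deriv_eq ?_
        filter_upwards [Ioi_mem_nhds ht] with s hs using hηρ s hs
      have hcongr : ∫ t in Ioo 0 T, ∫ x, (θ t x - θ' t x) * (deriv η t * g x) =
          ∫ t in Ioo 0 T, (deriv ρ t - 0 * ρ t) • F t := by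
        refine setIntegral_congr_fun measurableSet_Ioo fun t ht => ?_
        rw [zero_mul, sub_zero, smul_eq_mul, hF, ← hderiv t (by linarith [ht.1])]
        simp only
        rw [← MeasureTheory.integral_const_mul]
        refine integral_congr_ae (Eventually.of_forall fun x => ?_)
        ring
      rw [← hcongr, hU4, smul_zero, add_zero]
    have hode := Literature.Analysis.FunctionSpaces.ae_eq_exp_smul_of_forall_integral_deriv_sub
      (F := ℝ) hFint 0 0 key
    filter_upwards [hode] with t ht
    simpa using ht
  -- Step 2: all Fourier coefficients of `δ(t)` vanish, for a.e. `t`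
  have hint : ∀ᵐ t ∂((volume : Measure ℝ).restrict (Ioo 0 T)), Integrable (fun x => θ t x - θ' t x) volume :=
    hδi.prod_right_ae
  have hcoef : ∀ᵐ t ∂((volume : Measure ℝ).restrict (Ioo 0 T)), ∀ k : Fin 2 → ℤ,
      mFourierCoeff (fun x => ((θ t x - θ' t x : ℝ) : ℂ)) k = 0 := by
    rw [ae_all_iff]
    intro k
    filter_upwards [hstep _ (Literature.Analysis.FunctionSpaces.Torus.isSmooth_re_trigPoly {-k} (fun _ => (1 : ℂ))),
      hstep _ (Literature.Analysis.FunctionSpaces.Torus.isSmooth_re_trigPoly {-k} (fun _ => Complex.I)), hint]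
      with t h1 hI hit
    have e1 := Literature.Analysis.FluidPDE.Torus.integral_mul_re_oneMode hit k 1
    have eI := Literature.Analysis.FluidPDE.Torus.integral_mul_re_oneMode hit k Complex.I
    rw [h1] at e1
    rw [hI] at eI
    apply Complex.ext
    · simpa using e1.symm
    · simp only [Complex.mul_re, Complex.I_re, zero_mul, Complex.I_im, one_mul, zero_sub] at eI
      simpa using eI.symm
  -- Step 3: Parseval
  obtain ⟨C, hC⟩ := ae_eLpNorm_slice_le h
  obtain ⟨C', hC'⟩ := ae_eLpNorm_slice_le h'
  filter_upwards [hcoef, hC, hC'] with t hc ht ht'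
  have hL : MemLp (fun x => θ t x - θ' t x) 2 volume := ht.1.sub ht'.1
  have hP := Literature.Analysis.FunctionSpaces.Torus.hasSum_sq_norm_mFourierCoeff
    (g := fun x => ((θ t x - θ' t x : ℝ) : ℂ)) hL.ofReal
  simp_rw [hc, norm_zero] at hP
  have h0 : ∫ x, ‖((θ t x - θ' t x : ℝ) : ℂ)‖ ^ 2 = 0 := by
    have hz : HasSum (fun _ : Fin 2 → ℤ => (0 : ℝ) ^ 2) 0 := by
      simp only [ne_eq, OfNat.ofNat_ne_zero, not_false_eq_true, zero_pow]
      exact hasSum_zero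
    exact hP.unique hz
  have hnn := (integral_eq_zero_iff_of_nonneg (fun x => sq_nonneg _) (hL.ofReal.integrable_norm_pow two_ne_zero)).1 h0
  filter_upwards [hnn] with x hx
  have hx' : ‖((θ t x - θ' t x : ℝ) : ℂ)‖ = 0 := pow_eq_zero_iff two_ne_zero |>.1 hx
  rw [Complex.norm_real, Real.norm_eq_abs, abs_eq_zero, sub_eq_zero] at hx'
  exact hx'

/-- **Bardos–Titi–Wiedemann 2012, Lemma 4 — discharged.** Existence (`shearTransport`, the
explicit solution of Bardos–Titi 2010, Thm. 2: `BardosTitiWiedemann2012_lemma4_exists` of the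
sibling Transport file) and uniqueness in `L^∞(0,T;L²(T²))`
(`ae_ae_eq_of_isWeakScalarTransportOn`, the duality argument of this file): "We omit the
elementary proof of the Lemma" (op. cit.). [cite: BardosTitiWiedemann2012, Lemma 4] -/
theorem BardosTitiWiedemann2012_lemma4_holds : BardosTitiWiedemann2012_lemma4 :=
  fun v hv w₀ hw₀ T hT =>
    ⟨BardosTitiWiedemann2012_lemma4_exists v hv w₀ hw₀ T hT,
      fun _ _ hw hw' => ae_ae_eq_of_isWeakScalarTransportOn hv hT hw hw'⟩

end Unique

end Literature.Barriers.AnomalousDissipation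

end
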